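/-
Origin: expansion seat `planner-pub-hodgecm-pv06-g6-0`, handover #1 v3 (DOC-ONLY: O14-R locator named, referee adv2-g36 X68; SUPERSEDES v2 e5dc59d7 in place 2026-08-18T13:47:10Z, itself superseding f4521912; code residue fbbb1909 identical v1=v2=v3; HANDOVER #1 12:55:16Z) md5 98cc7021542814c11b90ec31eedc7177 (870 l.); imports tree HodgeCM.PerL34.S4Strength + HodgeCM.PerL34.FockPrintBridge + Mathlib.Analysis.Calculus.Deriv.Comp only (no rewrite); lands FIRST of  (`HOME/pub-hodgecm-pv06-g6/lean/Pv06g6/ArchCOrbit.lean`, md5 98cc7021, 870 lines);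
landed by the gen-8 packager in gate run 30 as `HodgeCM/PerL34/ArchCOrbit.lean` (verbatim).
-/
/-
  HodgeCM/PerL34/ArchCOrbit.lean        (origin: pub-hodgecm-pv06-g6, WIP module `Pv06g6.ArchCOrbit`;
  session planner-pub-hodgecm-pv06-g6-0; v3 = DOC-ONLY update (O14-R locator named, referee adv2-g35 O14-R / adv2-g36 X68; code unchanged), DAG-NODE PROVER #06 gen 6; intended final place
  `HodgeCM/PerL34/ArchCOrbit.lean`, module `HodgeCM.PerL34.ArchCOrbit`; imports ONLY landed tree modules —
  no import rewrite at intake.)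

  # Lemma 4.1(c) WITHOUT the Gårding package: the orbit argument

  NODE N29 of HOME/LEMMAS.md = [PerL] v5 Lemma 4.1(c) (`lem:arch` (c)), statement ll. 488–490, proof
  ll. 513–523 — the pv06 lineage's node (seam S4 of LEMMAS.md §9).  KIND: KERNEL.  Nothing is cited, nothing is
  posited, no new constant; complete proofs; standard axioms.

  THE POINT.  Every typed S4 record in the tree and in the run-29/30 queues — pv06 `ArchCDatum` (ArchC.lean),
  pv08-g3 `ArchCCore` (S4Strength.lean), pv12-g3/g4 `FockAnalyticBridge` (ArchCFockAnalytic.lean), pv12-g7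
  `PrintedAnalyticSide` (FockPrintBridge.lean), pv11-g9 `ModelAnalyticSide` / `OpAnalyticSide` / `LinearSide` —
  carries a block of [SETUP D7] fields transcribing the printed step l. 517 "invariance (⟨Xφ,v⟩ = −⟨φ,Xv⟩) … would
  make it vanish on all Fock vectors": the smooth (Gårding) vectors `Sm i` of σ̂_i, `Sm_sub`, `Sm_dense`
  (Getz–Hahn GTM 300 Prop. 4.2.3), the derived action `Y`/`YR` with `Y_mem`/`YR_mem` (Lemma 4.2.2), and either the
  identity `inf_invariance` itself or the L²-side derivative `hH` from which pv05-g2 derives it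
  (`inf_invariance_of_oneParam`).  THIS FILE PROVES THAT NONE OF IT IS NEEDED.  The identity ⟨Xφ,v⟩ = −⟨φ,Xv⟩ is
  only ever used to show that the ANNIHILATOR
      N_{f,p}(σ̂_i) := {φ ∈ 𝓕^κ_∞ | 𝒯_{φ⊗Φ_f}(v)(p) = 0 for all v ∈ σ̂_i}
  is stable under 𝔲(W_∞); but that follows at GROUP level first:
  (1) [NODE N21] `invariance` 𝒯_{ω(g)Φ}(R(g)v) = 𝒯_Φ(v) and the frozen `hatσ_invariant` (σ̂_i is R(G)-stable,
      `R` a homomorphism) give 𝒯_{ω(g)Φ}(v) = 𝒯_Φ(R(g)⁻¹v), so if v ↦ 𝒯_Φ(v)(p) kills σ̂_i then so does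
      v ↦ 𝒯_{ω(g)Φ}(v)(p) for EVERY g ∈ U(W)(𝔸) (`vanish_omg_of_vanish`) — the whole ω-orbit of Φ annihilates;
  (2) along a curve e(s) in U(W)(𝔸) the H*-valued map s ↦ 𝒯_{ω(e(s))(φ⊗Φ_f)}(·)(p) is differentiable at 0 with
      derivative 𝒯_{(Xφ)⊗Φ_f}(·)(p) ([SETUP D5] `hF`: Fock vectors are smooth vectors of ω_∞ — the ONE analytic
      input kept); evaluated at a fixed v ∈ σ̂_i it is the identically-zero scalar function, so its derivative
      𝒯_{(Xφ)⊗Φ_f}(v)(p) vanishes (`hasDerivAt_apply_eq_zero`, Mathlib only: uniqueness of derivatives);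
  (3) hence N_{f,p}(σ̂_i) is a submodule (linearity of φ ↦ 𝒯_{φ⊗Φ_f}) stable under the real directions, hence
      under their ℂ-span ∋ the ladder operators (pv12-g3 `Fock.stable_of_mem_span`), hence = 𝓕^κ_∞ as soon as it
      contains φ⁰ ([NODE N28] `gen` = L4.1(b)) (`vanishes_of_generator_of_stable` = Layer B of ArchC.lean with
      the smooth-vector identity replaced by bare stability).
  No derivative on the L² side, no smooth vectors, no density, no continuity in v are used: dictionary entry D7
  (Gårding vectors) LEAVES the S4 input.

  CONTENTS.
  §0 `hasDerivAt_apply_eq_zero` (Mathlib only).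
  §1 `vanish_omg_of_vanish`, `vanish_of_hasDerivAt_orbit` (frozen interface `IsolationCore` + `C4a.PointedCore`).
  §2 `annihilatorIn`, `vanishes_of_generator_of_stable` (pure algebra).
  §3 `OrbitCore C P` := pv08-g3's D-free chart `ArchCCore C P` with the SIX fields `Sm, Y, Sm_sub, Sm_dense,
     Y_mem, inf_invariance` replaced by ONE field `orbit_stable` ("if the whole ω(G)-orbit of φ⊗Φ_f annihilates
     σ̂_i at p then so does (X_kφ)⊗Φ_f"); `OrbitCore.eigen_of_detected` (Lemma 4.1(c), semantic form, D-free),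
     `OrbitCore.occLeaf` (the leaf `OccLeaf C D` = `ArchCDatum.H_occ`'s conclusion); the REDUCTION CERTIFICATE
     `ArchCCore.toOrbitCore` (the old chart IMPLIES the new one; `toOrbitCore_eigen_iff` by `Iff.rfl`), so the new
     S4 input is weaker-or-equal by a kernel theorem; `orbit_stable_of_realDirections` (the field from `hF` +
     N21 + span bookkeeping alone).
  §4 D7-free siblings of the two bridge records: `FockOrbitBridge C D P` (= `FockAnalyticBridge` minus
     {`he`, `Sm`, `Sm_sub`, `Sm_dense`, `YR`, `YR_mem`, `hH`}) and `PrintedOrbitSide C D P RP kind lam hlam vac`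
     (= `PrintedAnalyticSide` minus the same seven), with `toOrbitCore`, `H_occ`, and the forgetful maps
     `FockOrbitBridge.ofAnalytic`, `PrintedOrbitSide.ofAnalytic` (old input ⇒ new input; deliberately NOT placed in pv12's
     `FockAnalyticBridge.*` / `PrintedAnalyticSide.*` dot-namespaces).
  §5 BY NAME at the model level: `ThetaModel.Open_occ_of_orbitCores`, `Open_occ_of_fockOrbitBridges`,
     `N29_occ_of_fockOrbitBridges`, `Open_occ_of_fockAnalyticBridges_viaOrbit` (pv12's binders feed the new theorem).

  LABELS (honest split, as in ArchC.lean): [NODE N21] `invariance`; [NODE N28] `gen`, `φ₀_eigen` (KERNEL on the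
  Fock side via pv12); [SETUP D4] linearity / continuity / density / `omg_ins` / `ιT`; [SETUP D5] `XR`, `e`,
  `ladder_span`, `hF` (print warrant, corrected per referee adv2-g34 O14 2026-08-18: FRÉCHET-smoothness of Fock/Schwartz
  vectors — Poulsen 1972, J. Funct. Anal. 9, Prop. 1.2 + Thm. 1.2, p. 93 [held copy p0007], PLUS the identification of
  the D_∞-topology on 𝒮 with the Schwartz topology ((D_∞(μ|Mp), Goodman) = (𝒮, Schwartz) by Folland 1989 p. 165 ((4.47), dμ(𝒥) = πi(D²+X²)) + Reed–Simon I App. to V.3 Lemmas 1–2 / Thm. V.13 (pp. 141–143) + Folland Thm. (4.45), locator NAMED by referee adv2-g35 O14-R (GAPS l. 9152), independently GAPS pv12g8-1) — composed with the bounded linear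
  Φ ↦ 𝒯_Φ(·)(g); Folland 1989 Thm. (4.45) [p0163 L41–43] / Prop. (4.49) [p0166 L34] warrant only L²-smoothness and the
  VALUE of dω(X));
  [DEFINITIONAL] `wOccurs_of_eigenvector`.  No [SETUP D7] label survives.  ABSOLUTE RULE kept: no statement of
  [PerL] / [QW8] / the 2001 programme enters as a hypothesis; no cited fact is added.
-/
import Summits.HodgeConjecture.HodgeCM.PerL34.S4Strength_2
import Summits.HodgeConjecture.HodgeCM.PerL34.FockPrintBridge
import Mathlib.Analysis.Calculus.Deriv.Comp

set_option autoImplicit false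

noncomputable section

namespace HodgeCM
namespace PerL34
namespace ArchC

open HodgeCM.Prior.Perl34File HodgeCM.Prior.Perl34File.Perl34

/-! ## §0  A curve of functionals vanishing identically on a vector (KERNEL, Mathlib only) -/

section Calculus

/-- **Uniqueness of derivatives, read on one vector.**  If a curve `L` of bounded functionals on a complex
normed space is differentiable at `s₀` with derivative `L'` (in operator norm) and `L s v = 0` for ALL `s`, then
`L' v = 0`: evaluation at `v` is a bounded linear map, so `s ↦ L s v` has derivative `L' v`, and it is the zero
function. -/
theorem hasDerivAt_apply_eq_zero {E : Type*} [NormedAddCommGroup E] [NormedSpace ℂ E]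
    {L : ℝ → E →L[ℂ] ℂ} {L' : E →L[ℂ] ℂ} {s₀ : ℝ} (hL : HasDerivAt L L' s₀) (v : E)
    (h : ∀ s, L s v = 0) : L' v = 0 := by
  have h₁ : HasDerivAt (fun s => L s v) (L' v) s₀ := by
    have hc := (((ContinuousLinearMap.apply ℂ ℂ v).restrictScalars ℝ).hasFDerivAt).comp_hasDerivAt s₀ hL
    simpa only [Function.comp_def, ContinuousLinearMap.coe_restrictScalars',
      ContinuousLinearMap.apply_apply] using hc
  have h₂ : HasDerivAt (fun s => L s v) 0 s₀ := by
    have hc : (fun s => L s v) = fun _ => (0 : ℂ) := funext h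
    rw [hc]
    exact hasDerivAt_const s₀ (0 : ℂ)
  exact h₁.unique h₂

end Calculus

/-! ## §1  The orbit lemma over the frozen interface -/

section Orbit

variable {H HG CG G SK SigIdx SigIdxG : Type*}
variable [NormedAddCommGroup H] [InnerProductSpace ℂ H] [CompleteSpace H]
variable [NormedAddCommGroup HG] [InnerProductSpace ℂ HG] [CompleteSpace HG]
variable [NormedAddCommGroup CG] [NormedSpace ℂ CG]
variable [Group G] [TopologicalSpace G] [TopologicalSpace SK]
variable {C : IsolationCore H HG CG G SK SigIdx SigIdxG} {P : C4a.PointedCore C}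

/-- [NODE N21] read on a single vector: 𝒯_{ω(g)Φ}(v) = 𝒯_Φ(R(g)⁻¹ v) (from 𝒯_{ω(g)Φ}(R(g)u) = 𝒯_Φ(u) at
u := R(g⁻¹)v, `R` a homomorphism — `rep_apply_inv` of ArchC.lean). -/
theorem TΦc_omg_apply
    (invariance : ∀ (h : G) (Φ : SK) (v : H), C.TΦc (C.omg h Φ) (C.R h v) = C.TΦc Φ v)
    (g : G) (Φ : SK) (v : H) : C.TΦc (C.omg g Φ) v = C.TΦc Φ (C.R g⁻¹ v) := by
  have h := invariance g Φ (C.R g⁻¹ v)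
  rwa [rep_apply_inv] at h

/-- **The orbit lemma** (replaces l. 517's infinitesimal identity at group level).  If the functional
v ↦ 𝒯_Φ(v)(p) kills the isotypic component σ̂_i, then so does v ↦ 𝒯_{ω(g)Φ}(v)(p) for EVERY g ∈ U(W)(𝔸): by
[NODE N21] 𝒯_{ω(g)Φ}(v) = 𝒯_Φ(R(g)⁻¹v) and σ̂_i is R-stable (frozen `hatσ_invariant`). -/
theorem vanish_omg_of_vanish
    (invariance : ∀ (h : G) (Φ : SK) (v : H), C.TΦc (C.omg h Φ) (C.R h v) = C.TΦc Φ v)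
    {Φ : SK} {p : P.Pt} {i : SigIdx} (h : ∀ v ∈ C.hatσ i, P.evalPt p (C.TΦc Φ v) = 0) (g : G) :
    ∀ v ∈ C.hatσ i, P.evalPt p (C.TΦc (C.omg g Φ) v) = 0 := fun v hv => by
  rw [TΦc_omg_apply invariance]
  exact h _ (C.hatσ_invariant i g⁻¹ v hv)

/-- **Differentiating the zero function along an orbit.**  If along a curve `e : ℝ → U(W)(𝔸)` the H*-valued map
s ↦ 𝒯_{ω(e s)Φ}(·)(p) has derivative 𝒯_Ψ(·)(p) at 0 ([SETUP D5] `hF` for Φ = φ⊗Φ_f, Ψ = (Xφ)⊗Φ_f), and the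
whole family annihilates σ̂_i at p, then so does Ψ.  KERNEL: `hasDerivAt_apply_eq_zero`. -/
theorem vanish_of_hasDerivAt_orbit {Φ Ψ : SK} {p : P.Pt} {i : SigIdx} (e : ℝ → G)
    (hd : HasDerivAt (fun s : ℝ => C4a.pointFunctional C P (C.omg (e s) Φ) p)
      (C4a.pointFunctional C P Ψ p) 0)
    (h : ∀ s : ℝ, ∀ v ∈ C.hatσ i, P.evalPt p (C.TΦc (C.omg (e s) Φ) v) = 0) :
    ∀ v ∈ C.hatσ i, P.evalPt p (C.TΦc Ψ v) = 0 := fun v hv =>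
  hasDerivAt_apply_eq_zero hd v fun s => h s v hv

end Orbit

/-! ## §2  Layer B without smooth vectors: bare stability of the annihilator (pure algebra) -/

section LayerB'

variable {F : Type*} [AddCommGroup F] [Module ℂ F] {V : Type*}

/-- The annihilator of a set `S` of vectors under a pairing `B`, linear in the first variable:
{φ | B φ v = 0 for all v ∈ S} — a ℂ-submodule. -/
def annihilatorIn (B : F →ₗ[ℂ] (V → ℂ)) (S : Set V) : Submodule ℂ F where
  carrier := {φ | ∀ v ∈ S, B φ v = 0}
  add_mem' {a b} ha hb v hv := by
    simp only [Set.mem_setOf_eq] at ha hb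
    rw [map_add, Pi.add_apply, ha v hv, hb v hv, add_zero]
  zero_mem' v _ := by
    rw [map_zero, Pi.zero_apply]
  smul_mem' c {a} ha v hv := by
    simp only [Set.mem_setOf_eq] at ha
    rw [map_smul, Pi.smul_apply, ha v hv, smul_zero]

/-- (Ported verbatim from the HodgeCMPerL package; no docstring in the source.) -/
@[simp] theorem mem_annihilatorIn (B : F →ₗ[ℂ] (V → ℂ)) (S : Set V) (φ : F) :
    φ ∈ annihilatorIn B S ↔ ∀ v ∈ S, B φ v = 0 := Iff.rfl

/-- **Layer B′** ([PerL] v5 ll. 516–518 with the smooth-vector identity replaced by bare stability): a pairing `B`,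
linear in φ, whose annihilator of `S` is stable under every `X k`, and which kills `S` at a generator φ⁰ of `F`
under the `X k` (= L4.1(b)), kills `S` everywhere.  (ArchC.lean's `pairing_vanishes_of_generator` is the case where
stability comes from ⟨Xφ,v⟩ = −⟨φ,Yv⟩ on a Y-stable `S`.) -/
theorem vanishes_of_generator_of_stable {ιX : Type*} (X : ιX → F →ₗ[ℂ] F) (S : Set V)
    (B : F →ₗ[ℂ] (V → ℂ))
    (hstab : ∀ (k : ιX) (φ : F), (∀ v ∈ S, B φ v = 0) → ∀ v ∈ S, B (X k φ) v = 0)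
    (φ₀ : F) (hgen : ∀ N : Submodule ℂ F, φ₀ ∈ N → (∀ k, ∀ φ ∈ N, X k φ ∈ N) → N = ⊤)
    (h₀ : ∀ v ∈ S, B φ₀ v = 0) : ∀ (φ : F), ∀ v ∈ S, B φ v = 0 := by
  have hN : annihilatorIn B S = ⊤ := hgen _ h₀ fun k φ hφ => hstab k φ hφ
  intro φ
  have hφ : φ ∈ annihilatorIn B S := by
    rw [hN]
    exact Submodule.mem_top
  exact hφ

end LayerB'

/-! ## §3  The D7-free chart `OrbitCore` and Lemma 4.1(c) from it -/

section Core

variable {H HG CG G SK SigIdx SigIdxG : Type*}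
variable [NormedAddCommGroup H] [InnerProductSpace ℂ H] [CompleteSpace H]
variable [NormedAddCommGroup HG] [InnerProductSpace ℂ HG] [CompleteSpace HG]
variable [NormedAddCommGroup CG] [NormedSpace ℂ CG]
variable [Group G] [TopologicalSpace G] [TopologicalSpace SK]

/-- **The D7-free chart of seam S4** = pv08-g3's `ArchCCore C P` (itself = every field of pv06's `ArchCDatum C D P`
except the D-dependent `wOccurs_of_eigenvector`) with the SIX Gårding-package fields `Sm`, `Y`, `Sm_sub`, `Sm_dense`,
`Y_mem`, `inf_invariance` REPLACED by the single field `orbit_stable`.  Field names, types, order and honest-split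
labels of the common fields are those of `ArchCDatum` (see ArchC.lean for the print references). -/
structure OrbitCore (C : IsolationCore H HG CG G SK SigIdx SigIdxG) (P : C4a.PointedCore C) where
  /-- [SETUP D5] 𝓕^κ_∞ := ⊗_b 𝓕^{κ_b}_b (l. 483–484). -/
  F : Type
  [instACG : AddCommGroup F]
  [instMod : Module ℂ F]
  /-- [SETUP D5] index of a family (X_k) of operators on 𝓕^κ_∞ (ladder operators, or real directions). -/
  ιX : Type
  /-- [SETUP D5] ω(X_k) on 𝓕^κ_∞. -/
  X : ιX → F →ₗ[ℂ] F
  /-- [SETUP D4] the compact torus T(L₀⊗ℝ) = ∏_b T_b (l. 485). -/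
  Tg : Type
  [instGrp : Group Tg]
  /-- [SETUP D4] T(L₀⊗ℝ) ⊂ U(W)(𝔸) = `G`. -/
  ιT : Tg →* G
  /-- [SETUP D4] the archimedean type w as a character of T(L₀⊗ℝ) (ll. 387–388, 485–486). -/
  w : Tg →* ℂ
  /-- [SETUP D4] w is unitary. -/
  w_norm : ∀ t, ‖w t‖ = 1
  /-- [SETUP D5] ω_∞(t) on 𝓕^κ_∞ for t ∈ T(L₀⊗ℝ). -/
  ωT : Tg → F →ₗ[ℂ] F
  /-- [SETUP D4] index of the fixed finite data Φ_f (l. 516). -/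
  FinIdx : Type
  /-- [SETUP D4] the pure tensor φ ⊗ Φ_f ∈ 𝒮^κ. -/
  ins : FinIdx → F → SK
  /-- [NODE N28 = L4.1(b)] the distinguished vector φ⁰ := ⊗_b φ⁰_b. -/
  φ₀ : F
  /-- [SETUP D4] Φ ↦ 𝒯_Φ is additive along `ins f` (l. 378–381). -/
  ins_add : ∀ (f : FinIdx) (φ ψ : F), C.TΦc (ins f (φ + ψ)) = C.TΦc (ins f φ) + C.TΦc (ins f ψ)
  /-- [SETUP D4] Φ ↦ 𝒯_Φ is homogeneous along `ins f`. -/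
  ins_smul : ∀ (f : FinIdx) (c : ℂ) (φ : F), C.TΦc (ins f (c • φ)) = c • C.TΦc (ins f φ)
  /-- [SETUP D4] ω(t)(φ ⊗ Φ_f) = (ω_∞(t)φ) ⊗ Φ_f for t in the torus. -/
  omg_ins : ∀ (f : FinIdx) (t : Tg) (φ : F), C.omg (ιT t) (ins f φ) = ins f (ωT t φ)
  /-- [NODE N21] (l. 382–383): 𝒯_{ω(h)Φ}(R(h)v) = 𝒯_Φ(v). -/
  invariance : ∀ (h : G) (Φ : SK) (v : H), C.TΦc (C.omg h Φ) (C.R h v) = C.TΦc Φ v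
  /-- [SETUP D4] pure-tensor detection (l. 514–515; pv05-g2 `pure_detect_of_dense` / pv11-g9 operator-side). -/
  pure_detect : ∀ (Φ : SK) (p : P.Pt) (v : H), P.evalPt p (C.TΦc Φ v) ≠ 0 →
    ∃ (f : FinIdx) (φ : F), P.evalPt p (C.TΦc (ins f φ) v) ≠ 0
  /-- [SETUP D5, infinitesimal; REPLACES the D7 block] **orbit stability**: if the functional v ↦ 𝒯_{ω(g)(φ⊗Φ_f)}(v)(p)
  kills σ̂_i for EVERY g ∈ U(W)(𝔸) — the whole ω-orbit of φ⊗Φ_f annihilates σ̂_i at p —, then so does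
  v ↦ 𝒯_{(X_kφ)⊗Φ_f}(v)(p).  In the intended model: ω(X_k)φ ⊗ Φ_f is the s-derivative at 0 of
  ω(exp sX_k)(φ⊗Φ_f) IN THE TOPOLOGY OF 𝒮^κ (Fock vectors are Fréchet-smooth vectors of ω_∞: Poulsen 1972 Prop. 1.2 +
  Thm. 1.2 p. 93 + the Schwartz-topology identification: (D_∞(μ|Mp), Goodman) = (𝒮, Schwartz) by Folland 1989 p. 165 ((4.47), dμ(𝒥) = πi(D²+X²)) + Reed–Simon I App. to V.3 Lemmas 1–2 / Thm. V.13 (pp. 141–143) + Folland Thm. (4.45), locator NAMED by referee adv2-g35 O14-R (GAPS l. 9152), independently GAPS pv12g8-1; Folland 1989 Thm. (4.45) /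
  Prop. (4.49) for the value of dω(X)) read through the continuous linear Φ ↦ 𝒯_Φ(·)(p), and the derivative of the
  zero function is zero — KERNEL below,
  `orbit_stable_of_realDirections` / `FockOrbitBridge.toOrbitCore`, from the field `hF` of the bridge records. -/
  orbit_stable : ∀ (k : ιX) (f : FinIdx) (p : P.Pt) (i : SigIdx) (φ : F),
    (∀ g : G, ∀ v ∈ C.hatσ i, P.evalPt p (C.TΦc (C.omg g (ins f φ)) v) = 0) →
      ∀ v ∈ C.hatσ i, P.evalPt p (C.TΦc (ins f (X k φ)) v) = 0
  /-- [NODE N28 = L4.1(b)] (ll. 483–485): φ⁰ generates 𝓕^κ_∞ under the X_k (pv12 `Fock.IsGeneratedBy`, KERNEL for the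
  explicit local models). -/
  gen : ∀ N : Submodule ℂ F, φ₀ ∈ N → (∀ k, ∀ φ ∈ N, X k φ ∈ N) → N = ⊤
  /-- [NODE N28 = L4.1(b)] (ll. 485–486): ω_∞(t)φ⁰ = w(t)⁻¹ φ⁰. -/
  φ₀_eigen : ∀ t : Tg, ωT t φ₀ = (w t)⁻¹ • φ₀

namespace OrbitCore

attribute [instance] OrbitCore.instACG OrbitCore.instMod OrbitCore.instGrp

variable {C : IsolationCore H HG CG G SK SigIdx SigIdxG} {P : C4a.PointedCore C}
variable (O : OrbitCore C P)

/-- The chart's eigenvector predicate (verbatim the shape of `ArchCCore.Eigen`): σ̂_i contains a non-zero joint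
eigenvector of `ιT(Tg)` of character `w`. -/
def Eigen (i : SigIdx) : Prop :=
  ∃ y ∈ C.hatσ i, y ≠ 0 ∧ ∀ t : O.Tg, C.R (O.ιT t) y = O.w t • y

/-- An eigen component is non-zero. -/
theorem ne_bot_of_eigen {i : SigIdx} (h : O.Eigen i) : C.hatσ i ≠ ⊥ := by
  obtain ⟨y, hy, hy0, -⟩ := h
  exact (Submodule.ne_bot_iff _).mpr ⟨y, hy, hy0⟩

/-- The restricted pairing B_{f,p}(φ)(v) := 𝒯_{φ⊗Φ_f}(v)(p) (l. 515–516), linear in φ. -/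
def pairing (f : O.FinIdx) (p : P.Pt) : O.F →ₗ[ℂ] (H → ℂ) where
  toFun φ := fun v => P.evalPt p (C.TΦc (O.ins f φ) v)
  map_add' φ ψ := by
    funext v
    simp only [Pi.add_apply]
    rw [O.ins_add, _root_.add_apply, map_add]
  map_smul' c φ := by
    funext v
    simp only [Pi.smul_apply, RingHom.id_apply]
    rw [O.ins_smul, _root_.smul_apply, map_smul]

/-- (Ported verbatim from the HodgeCMPerL package; no docstring in the source.) -/
@[simp] theorem pairing_apply (f : O.FinIdx) (p : P.Pt) (φ : O.F) (v : H) :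
    O.pairing f p φ v = P.evalPt p (C.TΦc (O.ins f φ) v) := rfl

/-- Stability of the annihilator of σ̂_i under the X_k: the orbit lemma (§1, from [NODE N21]) feeds `orbit_stable`. -/
theorem pairing_stable (f : O.FinIdx) (p : P.Pt) (i : SigIdx) (k : O.ιX) (φ : O.F)
    (h : ∀ v ∈ C.hatσ i, O.pairing f p φ v = 0) : ∀ v ∈ C.hatσ i, O.pairing f p (O.X k φ) v = 0 :=
  O.orbit_stable k f p i φ (vanish_omg_of_vanish O.invariance h)

/-- Ll. 514–518 WITHOUT smooth vectors: from a non-zero point value 𝒯_Φ(v)(p), v ∈ σ̂_i, to a vector v₁ OF σ̂_i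
ITSELF with 𝒯_{φ⁰⊗Φ_f}(v₁)(p) ≠ 0 — pure-tensor detection, then Layer B′ read contrapositively.  (Compare
`ArchCCore.exists_smooth_ne_zero`, which produces a SMOOTH v₁ and needs density + continuity to come back.) -/
theorem exists_ne_zero (Φ : SK) (i : SigIdx) (p : P.Pt) (v : H) (hv : v ∈ C.hatσ i)
    (h : P.evalPt p (C.TΦc Φ v) ≠ 0) :
    ∃ f : O.FinIdx, ∃ v₁ ∈ C.hatσ i, P.evalPt p (C.TΦc (O.ins f O.φ₀) v₁) ≠ 0 := by
  obtain ⟨f, φ₁, hφ₁⟩ := O.pure_detect Φ p v h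
  refine ⟨f, ?_⟩
  by_contra hnone
  have hnone' : ∀ v₁ ∈ C.hatσ i, O.pairing f p O.φ₀ v₁ = 0 := fun v₁ hv₁ => by
    by_contra hne
    exact hnone ⟨v₁, hv₁, hne⟩
  have hvan : ∀ φ : O.F, ∀ u ∈ C.hatσ i, O.pairing f p φ u = 0 :=
    vanishes_of_generator_of_stable O.X (C.hatσ i : Set H) (O.pairing f p)
      (fun k φ hφ => O.pairing_stable f p i k φ hφ) O.φ₀ O.gen hnone'
  exact hφ₁ (hvan φ₁ v hv)

/-- Ll. 520–521: the covariance l(R(t)u) = w(t)·l(u) of l = 𝒯_{φ⁰⊗Φ_f}(·)(p) — from [NODE N21], `omg_ins`,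
[NODE N28] `φ₀_eigen` and linearity (proof verbatim `ArchCDatum.covariant`). -/
theorem covariant (f : O.FinIdx) (p : P.Pt) (t : O.Tg) (u : H) :
    P.evalPt p (C.TΦc (O.ins f O.φ₀) (C.R (O.ιT t) u)) =
      O.w t * P.evalPt p (C.TΦc (O.ins f O.φ₀) u) := by
  have hw0 : O.w t ≠ 0 := by
    intro h
    have h1 := O.w_norm t
    rw [h, norm_zero] at h1
    exact zero_ne_one h1
  have hφ : O.ωT t (O.w t • O.φ₀) = O.φ₀ := by
    rw [map_smul, O.φ₀_eigen, smul_smul, mul_inv_cancel₀ hw0, one_smul]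
  calc P.evalPt p (C.TΦc (O.ins f O.φ₀) (C.R (O.ιT t) u))
      = P.evalPt p (C.TΦc (O.ins f (O.ωT t (O.w t • O.φ₀))) (C.R (O.ιT t) u)) := by rw [hφ]
    _ = P.evalPt p (C.TΦc (C.omg (O.ιT t) (O.ins f (O.w t • O.φ₀))) (C.R (O.ιT t) u)) := by
          rw [O.omg_ins]
    _ = P.evalPt p (C.TΦc (O.ins f (O.w t • O.φ₀)) u) := by rw [O.invariance]
    _ = O.w t * P.evalPt p (C.TΦc (O.ins f O.φ₀) u) := by
          rw [O.ins_smul, _root_.smul_apply, map_smul, smul_eq_mul]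

/-- **Lemma 4.1(c), semantic form, from the D7-free chart** ([PerL] v5 ll. 488–490, proof ll. 513–523 with the step
l. 517 replaced by the orbit argument): if 𝒯_Φ|_{σ̂_i} ≠ 0 then σ̂_i contains a non-zero vector on which T(L₀⊗ℝ)
acts by w.  Layer A (`exists_eigenvector_of_covariant_functional`, ArchC.lean) is applied to v₁ ∈ σ̂_i directly. -/
theorem eigen_of_detected (Φ : SK) (i : SigIdx) (h : ∃ v ∈ C.hatσ i, C.TΦ Φ v ≠ 0) : O.Eigen i := by
  show ∃ y ∈ C.hatσ i, y ≠ 0 ∧ ∀ t : O.Tg, C.R (O.ιT t) y = O.w t • y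
  obtain ⟨v, hv, hTv⟩ := h
  obtain ⟨p, hp⟩ := C4a.exists_evalPt_ne_zero C P (C4a.TΦc_ne_zero C hTv)
  obtain ⟨f, v₁, hv₁, hl⟩ := O.exists_ne_zero Φ i p v hv hp
  have key := exists_eigenvector_of_covariant_functional (C.R.comp O.ιT)
    (fun t u u' => C.R_unitary (O.ιT t) u u') O.w O.w_norm (C.hatσ i)
    (fun t u hu => C.hatσ_invariant i (O.ιT t) u hu) (C.eσ i) (C.eσ_mem i) (C.eσ_fix i)
    (C.eσ_selfAdjoint i) (C4a.pointFunctional C P (O.ins f O.φ₀) p)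
    (fun t u => O.covariant f p t u) hv₁ hl
  simpa only [MonoidHom.coe_comp, Function.comp_apply] using key

/-- **The leaf from a D7-free chart**: if every eigen component has `wOccurs` (the [DEFINITIONAL] reading of the
bare frozen predicate), then `OccLeaf C D` — verbatim the conclusion of `ArchCDatum.H_occ` / one half of
`ThetaModel.Open_occ` in one context. -/
theorem occLeaf (D : TorusData C) (h : ∀ i, O.Eigen i → D.wOccurs i) : OccLeaf C D :=
  fun Φ i hd => h i (O.eigen_of_detected Φ i hd)

end OrbitCore

/-! ### The reduction certificate: the old chart implies the new one -/

namespace ArchCCore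

variable {C : IsolationCore H HG CG G SK SigIdx SigIdxG} {P : C4a.PointedCore C}


-- port_pkg: scope closed for this part
end ArchCCore
end Core
end ArchC
end PerL34
end HodgeCM
end
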